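import Summits.QuantumFields.YangMills.Theorems.PencilRigidityDiagonalMirrorRPRCentreClosed

/-!
# Strategist sketch (cstrat, crux stmt-QuantumFields-10604 `DiagonalMirrorRPR`) — typed forms used in STRATEGY-CENSUS.md

Nothing here is a line or a stub; these are the signatures the census refers to, elaborated against the landed vocabulary
(`CurvaturePackage`, `DiagonalFrameRP`, `CoverInsensitivityOffDiag`).
-/

set_option autoImplicit false

noncomputable section

open scoped SchwartzMap
open MeasureTheory Filter Topology
open Literature.MathematicalPhysics.QuantumLattice Literature.MathematicalPhysics.AQFT
  Literature.MathematicalPhysics.QuantumFieldTheory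

namespace Summit.QuantumFields.YangMills.Cruxes.DiagonalMirrorRPR.Strategist

open ParityBridgeColdTraces

/-- Sub-scheme along a strictly increasing reindexing `φ` (census §Decomposition: the scope piece N' narrows from
"`β_k < 0` frequently" to "`β_k < 0` eventually" by passing to the subsequence of non-negative couplings when it is infinite). -/
def subScheme {ι : Type} (sch : SpeciesScheme ι) (φ : ℕ → ℕ) (hφ : StrictMono φ) : SpeciesScheme ι where
  a := sch.a ∘ φ
  a_pos := fun k => sch.a_pos (φ k)
  tendsto_a := sch.tendsto_a.comp hφ.tendsto_atTop
  β := sch.β ∘ φ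
  L := sch.L ∘ φ
  tendsto_L := sch.tendsto_L.comp hφ.tendsto_atTop
  c := fun s => sch.c s ∘ φ
  m := fun s => sch.m s ∘ φ

/-- **Subsequence closure of the package** (census §Decomposition, refinement available but not filed): `W₁` passes to every
sub-scheme (hconv: `Tendsto` along `φ → ∞`; OS clauses: about `S₁` only; `HasLatticeMassGap`: `∀ᶠ` along `φ`). Stated, not proved here. -/
def PackageSubsequenceClosed : Prop :=
  ∀ (G : Type) [Group G] [TopologicalSpace G] [IsTopologicalGroup G] [CompactSpace G]
    [MeasurableSpace G] [BorelSpace G], IsCompactSimpleLieGroup G →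
    ∀ (r : LatticeRep G) (sch : SpeciesScheme (YMSpecies G)) (S₁ : SchwingerFamily E4)
      (φ : ℕ → ℕ) (hφ : StrictMono φ), CurvaturePackage r sch S₁ → CurvaturePackage r (subScheme sch φ hφ) S₁

/-- **N'' — the narrowed scope piece** (census §Decomposition): the crux on centre-blind data with EVENTUALLY negative couplings.
With `PackageSubsequenceClosed` and the transport T, N'' replaces N' (`stub_centreBlindNegativeScope`, "frequently") in the landed
composition `CentreTwistedSwap.Reduction.stub_crux_of_transport`. Leverless for the same reason as N' (no diagonal Schur cut at `β < 0`). -/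
def CentreBlindEventuallyNegativeScope : Prop :=
  ∀ (G : Type) [Group G] [TopologicalSpace G] [IsTopologicalGroup G] [CompactSpace G]
    [MeasurableSpace G] [BorelSpace G], IsCompactSimpleLieGroup G →
    ∀ (r : LatticeRep G) (sch : SpeciesScheme (YMSpecies G)) (S₁ : SchwingerFamily E4),
      CurvaturePackage r sch S₁ → (¬ ∃ z ∈ Subgroup.center G, r.ρ z = -1) → (∀ᶠ k in atTop, sch.β k < 0) →
        DiagonalFrameRP S₁

/-- **U — the "package upgrade" form of the transport** (census §Decomposition, the piece that remains the whole crux):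
every `W₁`-triple with eventually non-negative couplings also has convergent curvature strings on the 45° covers, to the SAME `S₁`.
Definitionally between T (`CoverInsensitivityOffDiag`) and a1's restatement antecedent; existence-level (finite-size /
sheet-swap-twist insensitivity of 4D Wilson theory at physical scale along an arbitrary scheme). -/
def PackageUpgrade : Prop :=
  ∀ (G : Type) [Group G] [TopologicalSpace G] [IsTopologicalGroup G] [CompactSpace G]
    [MeasurableSpace G] [BorelSpace G], IsCompactSimpleLieGroup G →
    ∀ (r : LatticeRep G) (sch : SpeciesScheme (YMSpecies G)) (S₁ : SchwingerFamily E4),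
      CurvaturePackage r sch S₁ → (∀ᶠ k in atTop, 0 ≤ sch.β k) → CoverInsensitivityOffDiag r sch

/-- Sanity: U is literally T of the residual skeleton (same proposition). -/
example : PackageUpgrade ↔
    (∀ (G : Type) [Group G] [TopologicalSpace G] [IsTopologicalGroup G] [CompactSpace G]
      [MeasurableSpace G] [BorelSpace G], IsCompactSimpleLieGroup G →
      ∀ (r : LatticeRep G) (sch : SpeciesScheme (YMSpecies G)) (S₁ : SchwingerFamily E4),
        CurvaturePackage r sch S₁ → (∀ᶠ k in atTop, 0 ≤ sch.β k) → CoverInsensitivityOffDiag r sch) := Iff.rfl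

end Summit.QuantumFields.YangMills.Cruxes.DiagonalMirrorRPR.Strategist

end
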